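import Summits.BirchSwinnertonDyer.Rank1Residual.X11b.Three.ClassRecordKoly
import Summits.BirchSwinnertonDyer.BirchSwinnertonDyer.Theorems.RungK2Hub
import HarnessLib

/-!
# Rung-K2 import hub, KOLY extension — the K2@3 leaf from the KOLY RECORD (cell `bsd-stepL`, seat
# `bsd-stepL-koly` g6; kernel K-1 of `plan/K2KOLY/DESIGN.md`: the `closes` shape of the designed route
# `KolyvaginRoadThree`; route files import THIS Theorems module to see `Three.forall_bsdp_of_kolyRecord`)

`X11b.multiplicativeRankOneAtThree_of_kolyRecord` : the rung-K2b leaf `X11b.MultiplicativeRankOneAtThree`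
(`RungK2Leaves.lean` :81, p404842) from the binders of `Three.forall_bsdp_of_kolyRecord`
(`X11b/Three/ClassRecordKoly.lean`): the twenty published named facts of the class record v4.5′, the KOLYVAGIN
ROAD on A1 (`hA1 : ClassX11b W 3 → Ram W 3 → ¬ 3 ∣ ∏c → BSDp W 3`), road (a) and road (b)'s halves RESTRICTED
to `3 ∣ ∏c`, and the shared residual binders verbatim — a re-packaging, nothing more (same pattern as
`multiplicativeRankOneAtThree_of_classRecord`). A Theorems-side module (not an append to `RungK2Leaves.lean` ∕
`RungK2Hub.lean`) so that no import line of an existing module changes and a route file can import it directly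
(`imports: [Summits.BirchSwinnertonDyer.BirchSwinnertonDyer.Theorems.RungK2HubKoly]`, closure ⊇ `RungK2Hub`'s).
CONDITIONAL on every binder; nothing asserted; no `sorry`.
-/

noncomputable section

open scoped Classical

open WeierstrassCurve NumberField IsDedekindDomain Field
open Literature.NumberTheory.EllipticCurves Literature.NumberTheory.EllipticCurves.GreenbergSelmer
  Rat.HeightOneSpectrum
  Literature.NumberTheory.DiophantineGeometry
  Literature.NumberTheory.EllipticCurves.ModularForms
  Literature.NumberTheory.EllipticCurves.Rank1Residual
  Literature.NumberTheory.EllipticCurves.Rank1Residual.Typed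
  Literature.NumberTheory.EllipticCurves.Wuthrich2014
  Literature.NumberTheory.EllipticCurves.BalakrishnanEtAl2019
  Literature.NumberTheory.EllipticCurves.Skinner2016
  Literature.NumberTheory.EllipticCurves.SteinWuthrich2013
  Literature.NumberTheory.EllipticCurves.Disegni2020
  Literature.NumberTheory.EllipticCurves.BarriosEtAl2025
  Literature.NumberTheory.QuadraticFields.Quadratic
  Literature.NumberTheory.Automorphic
  Literature.NumberTheory.GaloisRepresentations Literature.NumberTheory.GaloisCohomology
  Summit.BirchSwinnertonDyer.Rank1Residual.X11b.AcSelmer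
  Summit.BirchSwinnertonDyer.Rank1Residual.X11b.LocBridge

namespace Summit.BirchSwinnertonDyer.Rank1Residual.X11b

/-- **K2b leaf from the KOLY RECORD** (`closes` shape of the designed route `KolyvaginRoadThree`):
`X11b.MultiplicativeRankOneAtThree` from the twenty PUBLISHED named facts, the Kolyvagin road on A1 (`hA1`), road (a)
and road (b)'s halves on the Tamagawa cells only (`hReg`, `hHb` with `3 ∣ ∏c`), and the shared residual inputs — a
re-packaging of `Three.forall_bsdp_of_kolyRecord`, nothing more. CONDITIONAL on every binder; nothing booked.
[folklore] -/
theorem multiplicativeRankOneAtThree_of_kolyRecord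
    -- PUBLISHED: the named facts of route p2, WITHOUT `hEP` (as v4.5′)
    (hGZ : ∀ (N : ℕ) [NeZero N] (W : WeierstrassCurve ℚ) (K : Type) [Field K] [NumberField K],
      gross_zagier N W K)
    (hKo : ∀ (N : ℕ) [NeZero N] (W : WeierstrassCurve ℚ) (K : Type) [Field K] [NumberField K],
      kolyvagin N W K)
    (hB : ∀ (N : ℕ) [NeZero N] (W : WeierstrassCurve ℚ) (K : Type) [Field K] [NumberField K],
      Kolyvagin1990_padicValNat_card_sha_le N W K)
    (hSk : Skinner2016.thmC_padicValRat_bsd_rank_zero) (hWu : sha_dvd_analyticSha)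
    (hGZK : rank_eq_analyticRank_of_analyticRank_le_one) (hmod : hasEntireLFunction_rat)
    (hnf : exists_isNewformOf) (hHL : HoffsteinLuo1997_exists_twist_L_one_ne_zero)
    (hMaz : mazur_not_dvd_maninConstant_of_odd)
    (hPT : ∀ (K : Type) [Field K] [NumberField K], poitouTate_sum_localTatePairing_eq_zero K)
    (hFH : friedbergHoffstein_exists_twist_ne_zero_inertAt)
    (hBR : localTamagawaNumber_quadraticTwist_two_mem_of_goodReduction)
    (hSkA : thmA_charIdeal_multiplicative) (hJn : thm61_nonsplitMultiplicative)
    (hHn : exists_isMultCanonical) (hD : thm1_padicBSD_rankOne_multiplicative)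
    (hpar : nonempty_modularParametrizationData)
    (hMN : ∀ (N : ℕ) [NeZero N] (W : WeierstrassCurve ℚ) (K : Type) [Field K] [NumberField K],
      MatarNekovar2019.thm03_padicValNat_card_sha_le_of_irreducible N W K)
    (hH : hsieh2014_exists_anticyclotomicPAdicLFunction)
    -- THE KOLYVAGIN ROAD on A1 = (ram) ∧ 3 ∤ ∏c
    (hA1 : ∀ (W : WeierstrassCurve ℚ) [W.IsElliptic] [W.IsGloballyMinimal],
      ClassX11b W 3 → Ram W 3 → ¬ 3 ∣ W.tamagawaProduct → BSDp W 3)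
    -- ROAD (a) NONSPLIT(3) ∧ (ram) ∧ 3 ∣ ∏c: Schneider at 3, RESTRICTED to the Tamagawa cells
    (hReg : ∀ (W : WeierstrassCurve ℚ) [W.IsElliptic] [W.IsGloballyMinimal],
      ClassX11b W 3 → Ram W 3 → ¬ W.HasSplitMultiplicativeReductionAtPrime 3 → 3 ∣ W.tamagawaProduct →
        ClassClosure.RegulatorNonvanishingAt W 3)
    -- ROAD (b) SPLIT(3) ∧ (ram): the named descent residual (as v4.5′) …
    (hDb : ∀ (W : WeierstrassCurve ℚ) [W.IsElliptic] [W.IsGloballyMinimal],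
      ClassX11b W 3 → Ram W 3 → W.HasSplitMultiplicativeReductionAtPrime 3 → Three.HsiehDescentAt₃ W)
    -- … and the halves H2 ∧ H3, RESTRICTED to the Tamagawa cells
    (hHb : ∀ (W : WeierstrassCurve ℚ) [W.IsElliptic] [W.IsGloballyMinimal],
      ClassX11b W 3 → Ram W 3 → W.HasSplitMultiplicativeReductionAtPrime 3 → 3 ∣ W.tamagawaProduct →
        Three.BDPValueAt₃ W ∧ Three.IMCDivAt₃ W)
    -- (T2♯-ℝ)₃ Shimura displays on split ∧ (ram) ∧ pure-β (as v4.5′)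
    (hSh : ∀ (W : WeierstrassCurve ℚ) [W.IsElliptic] [W.IsGloballyMinimal],
      ClassX11b W 3 → Ram W 3 → W.HasSplitMultiplicativeReductionAtPrime 3 → ¬ Three.ShapeAlpha W →
        ¬ Three.ShapeGamma W → 3 ∣ W.tamagawaProduct → P2ShimuraDisplaysAt W 3)
    -- (T2′)₃ Euler-system halves (as v4.5′)
    (hUα : ∀ (W : WeierstrassCurve ℚ) [W.IsElliptic] [W.IsGloballyMinimal],
      ClassX11b W 3 → Ram W 3 → Three.ShapeAlpha W → Typed.MissingUpperBoundAt W 3)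
    (hUγ : ∀ (W : WeierstrassCurve ℚ) [W.IsElliptic] [W.IsGloballyMinimal],
      ClassX11b W 3 → Ram W 3 → W.HasSplitMultiplicativeReductionAtPrime 3 → ¬ Three.ShapeAlpha W →
        Three.ShapeGamma W → Typed.MissingUpperBoundAt W 3)
    -- ROAD (d) `¬Ram ∧ Surj` (as v4.5′)
    (hDd : ∀ (W : WeierstrassCurve ℚ) [W.IsElliptic] [W.IsGloballyMinimal],
      ClassX11b W 3 → ¬ Ram W 3 → Surj W 3 → Three.HsiehDescentAt₃ W)
    (hHd : ∀ (W : WeierstrassCurve ℚ) [W.IsElliptic] [W.IsGloballyMinimal],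
      ClassX11b W 3 → ¬ Ram W 3 → Surj W 3 → Three.BDPValueAt₃ W ∧ Three.IMCDivAt₃ W)
    (hU₀ : ∀ (W : WeierstrassCurve ℚ) [W.IsElliptic] [W.IsGloballyMinimal],
      ClassX11b W 3 → Surj W 3 → ¬ Ram W 3 → Typed.MissingUpperBoundAt W 3)
    -- THE (T4″)@3 CORNER (as v4.5′)
    (hCL : ∀ (W : WeierstrassCurve ℚ) [W.IsElliptic] [W.IsGloballyMinimal], Three.CornerStepLAt W)
    (hCT : ∀ (W : WeierstrassCurve ℚ) [W.IsElliptic] [W.IsGloballyMinimal], Three.CornerTwistAt W)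
    (hCU : ∀ (W : WeierstrassCurve ℚ) [W.IsElliptic] [W.IsGloballyMinimal], Three.CornerUpperAt W) :
    MultiplicativeRankOneAtThree :=
  fun W _ _ hX ↦
    Three.forall_bsdp_of_kolyRecord hGZ hKo hB hSk hWu hGZK hmod hnf hHL hMaz hPT hFH hBR hSkA hJn hHn hD hpar
      hMN hH hA1 hReg hDb hHb hSh hUα hUγ hDd hHd hU₀ hCL hCT hCU W hX

end Summit.BirchSwinnertonDyer.Rank1Residual.X11b

end
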